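import Summits.HodgeConjecture.HodgeConjecture.Theorems.R90S9HcoeffMemAtDatumA2
import Summits.HodgeConjecture.HodgeConjecture.Theorems.R90S9HcoeffMemAtUnitsOfRecordPartnerA
import HarnessLib

/-!
# R90-TF · S9 «InnerForm-13.3.6 (c)» — THE (CMP) CHAIN «A2» (two-member archimedean packet): `tupleOfA2` → `recordSCDA2` → ROW-34 TOKEN `…_atUnitsOfRecord_partnerA2'`
# (Rogawski 1990 §12.3 Prop. 12.3.3 p. 178: `Π(ξ_ι) = {πⁿ(ξ_ι), πˢ(ξ_ι)}`; §14.6 Thm. 14.6.4 proof p. 244: at `v ∉ S₀` — the indefinite place `ι` included — the factor is two-member, `(−)` on the `G`-side, `(+)` on the `H`-side)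

Cell `hodgecm-mathlib`, crux H413 (`stmt-HodgeConjecture-24833`, lane `--supports … --as helper`), route `HCCMUnconditional` (count-neutral); R90-TF S9, seat R90-IF-p03 (g3);
module M2b of R90-IF-plan (g2)'s ruling 01:28:48Z on FLAG F-R3-arch (R90-IF-p07; RULED «BITES»): the ★ one-class (CMP) chain carried ONE archimedean class `a₀` (`+1` in
both local identities), print has `Π′(ξ_ι) = {πⁿ, πˢ}` at the indefinite place `ι ∉ S₀` and `K_c`-bi-invariant tests see both.  THIS FILE = the chain above ★ M2a
`hcoeffMem_gammaSphA2` (R90-IF-p07): each § is its ★ one-class predecessor (★ p862494 ∕ ★ p862535 ∕ ★ p863643) with the letter group `a₀ ha₀ hR₁ hR₂` ↦ `a₀ a₂ ha₀ ha₂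
hane … cpt hR₁(−) hR₂(+) hR₀G hR₀H` (p07's `A2-STATEMENTS.lean`; in `hR₀G ∕ hR₀H` the test binder carries its type ascription — same binder type, needed for elaboration)
and NOTHING else changed; proofs = the ★ proofs with the group threaded.  THEOREMS ONLY: no `def`, no instance, no notation, no named fact, no `sorry`; imports ★ only.
HONEST LABEL: HC_CM is proved only modulo the 7 printed citations (2 remaining named inputs: hLiu418 = stmt-HodgeConjecture-24832, h413 = stmt-HodgeConjecture-24833) —
until rung 0 closes.  Re-typing of hypothesis SHAPES; proves no printed statement; closes no leaf.  Residual letters as in ★ p863643 with the A2 group.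
[cite: Rogawski1990, §12.3 Prop. 12.3.3 p. 178; §13.1 Prop. 13.1.4 p. 199; §14.4 Props. 14.4.1 (a)(c), 14.4.2 (c) p. 236; §14.6 Thm. 14.6.4 and its proof pp. 244–245] [cite: FlathCorvallis1979, Thm. 3 and Thm. 4]
-/

set_option autoImplicit false
set_option linter.dupNamespace false

noncomputable section

namespace Summit.HodgeConjecture.HodgeConjecture.R90.S9

open Finset Filter
open Literature.NumberTheory Literature.NumberTheory.Automorphic Literature.NumberTheory.GaloisRepresentations
open NumberField IsDedekindDomain MeasureTheory
open Literature.NumberTheory.Rogawski1990 Literature.NumberTheory.Automorphic.UnitaryGroup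
open Literature.NumberTheory.Automorphic.UnitaryGroup.CotangentForms (cmCompactFactor)
open Literature.RepresentationTheory.KonnoKonno2007 Literature.RepresentationTheory.KonnoKonno2007.RealDualPair
open Literature.RepresentationTheory.KonnoKonno2007.RealDualPair.UForm
open Summit.HodgeConjecture.HodgeConjecture.Cruxes.H413 Summit.HodgeConjecture.HodgeConjecture.Cruxes.H413.F0P3ClassTokenChoice
open Summit.HodgeConjecture.HodgeConjecture.Cruxes.H413.F0P3GlobalPacket Summit.HodgeConjecture.HodgeConjecture.Cruxes.H413.F0P3LocalPacketKit
open Summit.HodgeConjecture.HodgeConjecture.Cruxes.H413.F0P3UnitaryLocOfRecord (IsCohUnitaryClass)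
open Summit.HodgeConjecture.HodgeConjecture.Cruxes.H413.F0P3XiLocalFamilyOfRecord Summit.HodgeConjecture.HodgeConjecture.Cruxes.H413.F0P3XiPacketFamilyOfRecord
open Summit.HodgeConjecture.HodgeConjecture.Cruxes.H413.F0P3XiPacketFamilyOfRecordSCD
open InnerFormSec146
open scoped Matrix MatrixGroups Classical ComplexOrder

section ChainA2

variable (L : Type) [Field L] [NumberField L] [IsCMField L] (ι₀ : L →+* ℂ) (H : Matrix (Fin 3) (Fin 3) L)
  (T : GL (Fin 3) ℂ) (hT : (T : Matrix (Fin 3) (Fin 3) ℂ)ᴴ * H.map ι₀ * (T : Matrix (Fin 3) (Fin 3) ℂ) = Literature.Geometry.ComplexHyperbolic.BallModel.J)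
  (νinf : @Measure (UnitaryGroup.arch (↥(maximalRealSubfield L)) L (IsCMField.complexConj L) 3 H) (borel _))
  (μv : ∀ v : HeightOneSpectrum (𝓞 ↥(maximalRealSubfield L)), @Measure ((cmDatum L 3 H).Local v) (borel _))
  (hdef : ∀ τ' : L →+* ℂ, InfinitePlace.mk τ' ≠ InfinitePlace.mk ι₀ → (H.map τ').PosDef)
  (hν : @Measure.IsHaarMeasure _ _ _ (borel _) νinf)
  (hμ : ∀ v : HeightOneSpectrum (𝓞 ↥(maximalRealSubfield L)), @Measure.IsHaarMeasure _ _ _ (borel _) (μv v))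
  (e : ∀ v : HeightOneSpectrum (𝓞 ↥(maximalRealSubfield L)), (cmDatum L 3 H).Local v → ℂ)
  (he : ∀ v, IsLocallyConstant (e v) ∧ HasCompactSupport (e v))
  (hH : (H.map (cmConjRingHom L))ᵀ = H) (hHd : IsUnit H.det) (μω : HeckeCharacter L) (hμu : μω.IsUnitary)
  [∀ v : HeightOneSpectrum (𝓞 ↥(maximalRealSubfield L)), MeasurableSpace (Gqs L v ⧸ Subgroup.center (Gqs L v))]
  (μZ : ∀ v : HeightOneSpectrum (𝓞 ↥(maximalRealSubfield L)), Measure (Gqs L v ⧸ Subgroup.center (Gqs L v)))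
  (keys : ∀ (ξ : OneDimAutRepH L) (v : HeightOneSpectrum (𝓞 ↥(maximalRealSubfield L))),
    (∀ w : PlacesOver L v, IsCMField.complexConj L • w.1 = w.1) →
      {p : IrrClass (Gqs L v) × IrrClass (Gqs L v) //
        KeysCaseTwoLabels L v (μω.semilocalComponent L v) (torusLocalComponent L (IsCMField.complexConj L) v ξ.η)
          (torusLocalComponent L (IsCMField.complexConj L) v ξ.ψ) p.1 p.2 ∧
        p.1.IsSquareIntegrable (μZ v) ∧ ¬ p.2.IsSquareIntegrable (μZ v)})
  (hSC : ∀ (ξ : OneDimAutRepH L) (v : HeightOneSpectrum (𝓞 ↥(maximalRealSubfield L)))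
    (hns : ∀ w : PlacesOver L v, IsCMField.complexConj L • w.1 = w.1)
    (T : GL (Fin 3) (LocalRing L v)) (a : LocalRing L v) (ha : IsUnit a)
    (h : formCongr (conjLocal L (IsCMField.complexConj L) v) T (H.map (algebraMap L (LocalRing L v))) =
      a • (Matrix.of fun i j : Fin 3 => if i.val + j.val + 1 = 3 then (1 : L) else 0).map (algebraMap L (LocalRing L v)))
    (π2 πn : IrrClass (Gqs L v)),
    KeysCaseTwoLabels L v (μω.semilocalComponent L v) (torusLocalComponent L (IsCMField.complexConj L) v ξ.η)
      (torusLocalComponent L (IsCMField.complexConj L) v ξ.ψ) π2 πn → ¬ πn.IsSquareIntegrable (μZ v) →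
    {πs : IrrClass ((cmDatum L 3 H).Local v) // πs.IsSupercuspidal ∧ πs ≠ IrrClass.comap (cmDatumLocalCongr L v T ha h).symm πn})
  {TG TH : Type}
  (μA : Measure (adelicGroupData (↥(maximalRealSubfield L)) L (IsCMField.complexConj L) 3 H).automorphicQuotient)
  [(adelicGroupData (↥(maximalRealSubfield L)) L (IsCMField.complexConj L) 3 H).IsAutomorphicMeasure μA]
  (Ξ : OneDimAutRepH L → PacketPrimeFin L H)
  {H' : Matrix (Fin 3) (Fin 3) L}
  (𝔩 : ∀ v : HeightOneSpectrum (𝓞 ↥(maximalRealSubfield L)), LocalPacketKit L H' v)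

/-! ## §2 `hcoeffMem` «A2» at `Γ₀^{sph}` along `tupleOf` (= ★ p862494 `hcoeffMem_gammaSph_tupleOf` with the A2 letter group) -/
omit [∀ v : HeightOneSpectrum (𝓞 ↥(maximalRealSubfield L)), MeasurableSpace (Gqs L v ⧸ Subgroup.center (Gqs L v))] in
include hdef hν hμ he in
/-- **`hcoeffMem` «A2» AT `Γ₀^{sph} = gammaSph X`, ALONG `tupleOf`** — ★ `hcoeffMem_gammaSph_tupleOf` with the two-member archimedean letter group (`a₀ a₂ ha₀ ha₂ hane`,
guard `cpt`, `hR₁` (−) ∕ `hR₂` (+) under it, `hR₀G ∕ hR₀H` off it); proof = ★'s (`hspec` by `repOf`, `htupInj` by ★ `tupleOf_injective_of_letters` under F1b + «ARCH»,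
`htupW₀` by ★ `tup_mem_supportOfRecord_of_spec` from `he1`) into ★ M2a `hcoeffMem_gammaSphA2`.  CONCLUSION: `∀ π′, Γ.evpRep π′ P → Γ.m′ π′ ≠ 0 → Γ.mem′ π′ (Γ.PiXi′ ξ h₁ hS)`.
[cite: Rogawski1990, §12.3 Prop. 12.3.3 p. 178; §14.6 Thm. 14.6.4 and its proof pp. 244–245 (chunks p0238 L9 – p0239 L4); Prop. 13.8.1 p. 206] [cite: FlathCorvallis1979, Thm. 3 and Thm. 4] -/
theorem hcoeffMem_gammaSph_tupleOfA2
    (hanis : ∀ x : Fin 3 → L, Literature.AlgebraicGeometry.ShimuraVarieties.hermForm (cmConjRingHom L) H x x = 0 → x = 0)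
    (hF1b : ∀ P₀ Q₀ : DiscreteAutomorphicRep (adelicGroupData (↥(maximalRealSubfield L)) L (IsCMField.complexConj L) 3 H) μA,
      IsKcSpherical L ι₀ H T hT μA P₀ → IsKcSpherical L ι₀ H T hT μA Q₀ →
      P₀.UnitaryEquivOfComponents Q₀ (uFormGroup (Fin 2) (Fin 1)) (cmArchSectionUForm L ι₀ H T hT) (cmCompactFactor L ι₀ H T hT))
    (hARCH : ArchComponentOfDiscrete L ι₀ H T hT μA)
    (he1 : ∀ᶠ v : HeightOneSpectrum (𝓞 ↥(maximalRealSubfield L)) in Filter.cofinite, ∀ c : IrrClass ((cmDatum L 3 H).Local v),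
      c.IsAdmissible → c.IsSpherical (cmLocalIntegralLevel L 3 H v) →
        (letI : MeasurableSpace ((cmDatum L 3 H).Local v) := borel _; c.smoothTrace (μv v) (e v)) = 1)
    (X : DatumInputs ((UnitaryGroup.arch (↥(maximalRealSubfield L)) L (IsCMField.complexConj L) 3 H → ℂ) ×
        (∀ v : HeightOneSpectrum (𝓞 ↥(maximalRealSubfield L)), (cmDatum L 3 H).Local v → ℂ)) TG TH L ι₀ H T hT μA Ξ 𝔩)
    (Transfer : (UnitaryGroup.arch (↥(maximalRealSubfield L)) L (IsCMField.complexConj L) 3 H → ℂ) ×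
        (∀ v : HeightOneSpectrum (𝓞 ↥(maximalRealSubfield L)), (cmDatum L 3 H).Local v → ℂ) → TG → Prop)
    (TransferH : (UnitaryGroup.arch (↥(maximalRealSubfield L)) L (IsCMField.complexConj L) 3 H → ℂ) ×
        (∀ v : HeightOneSpectrum (𝓞 ↥(maximalRealSubfield L)), (cmDatum L 3 H).Local v → ℂ) → TH → Prop)
    (htrX : ∀ (π' : RepPrimeSph L ι₀ H T hT μA) (φf : (UnitaryGroup.arch (↥(maximalRealSubfield L)) L (IsCMField.complexConj L) 3 H → ℂ) ×
        (∀ v : HeightOneSpectrum (𝓞 ↥(maximalRealSubfield L)), (cmDatum L 3 H).Local v → ℂ)),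
      X.trPrime π' φf = archTr₀ L ι₀ H T hT νinf (tupleOf L ι₀ H T hT μA π').1 φf.1 *
        ∏ᶠ v, (letI : MeasurableSpace ((cmDatum L 3 H).Local v) := borel _;
          ((tupleOf L ι₀ H T hT μA π').2 v).smoothTrace (μv v) (φf.2 v)))
    {P : X.G.Packet} {ξ : X.G.PacketH} (h₁ : X.IsOneDimH ξ) (hS : ∀ q : InnerFormSec146.Place L, q ∈ S0 L H → X.MnNeZero ξ q)
    (p : HeightOneSpectrum (𝓞 ↥(maximalRealSubfield L)) → Prop)
    (a₀ a₂ : GKIrrClass (uFormGroup (Fin 2) (Fin 1)))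
    (ha₀ : ∃ r : GKIrrep (uFormGroup (Fin 2) (Fin 1)), GKIrrClass.mk r = a₀ ∧ IsAdmissibleGK r.ρK ∧ r.IsInfUnitaryAlongP)
    (ha₂ : ∃ r : GKIrrep (uFormGroup (Fin 2) (Fin 1)), GKIrrClass.mk r = a₂ ∧ IsAdmissibleGK r.ρK ∧ r.IsInfUnitaryAlongP)
    (hane : a₂ ≠ a₀)
    (hun : ∀ v, ((Ξ (X.oneDimOf ξ h₁) v).πn).IsUnitarizable)
    (hus : ∀ v, p v → ((Ξ (X.oneDimOf ξ h₁) v).πs.getD (Ξ (X.oneDimOf ξ h₁) v).πn).IsUnitarizable)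
    (hsph : {v | (letI : MeasurableSpace ((cmDatum L 3 H).Local v) := borel _;
      ((Ξ (X.oneDimOf ξ h₁) v).πn).smoothTrace (μv v) (e v)) ≠ 1}.Finite)
    (hne : ∀ i : {v // p v}, (Ξ (X.oneDimOf ξ h₁) (i : _)).πs.getD (Ξ (X.oneDimOf ξ h₁) (i : _)).πn ≠ (Ξ (X.oneDimOf ξ h₁) (i : _)).πn)
    (T₀ : (UnitaryGroup.arch (↥(maximalRealSubfield L)) L (IsCMField.complexConj L) 3 H → ℂ) ×
        (∀ v : HeightOneSpectrum (𝓞 ↥(maximalRealSubfield L)), (cmDatum L 3 H).Local v → ℂ) →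
      Finset (HeightOneSpectrum (𝓞 ↥(maximalRealSubfield L))))
    (hn1 : ∀ φf, (ArchTestKc L ι₀ H T hT φf.1 ∧ (∀ v, IsLocallyConstant (φf.2 v) ∧ HasCompactSupport (φf.2 v)) ∧ {v | φf.2 v ≠ e v}.Finite) →
      ∀ v ∉ T₀ φf, (letI : MeasurableSpace ((cmDatum L 3 H).Local v) := borel _;
        ((Ξ (X.oneDimOf ξ h₁) v).πn).smoothTrace (μv v) (φf.2 v)) = 1)
    (hs0 : ∀ φf, (ArchTestKc L ι₀ H T hT φf.1 ∧ (∀ v, IsLocallyConstant (φf.2 v) ∧ HasCompactSupport (φf.2 v)) ∧ {v | φf.2 v ≠ e v}.Finite) →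
      ∀ i : {v // p v}, (i : HeightOneSpectrum (𝓞 ↥(maximalRealSubfield L))) ∉ T₀ φf →
        (letI : MeasurableSpace ((cmDatum L 3 H).Local i) := borel _;
          ((Ξ (X.oneDimOf ξ h₁) (i : _)).πs.getD (Ξ (X.oneDimOf ξ h₁) (i : _)).πn).smoothTrace (μv i) (φf.2 i)) = 0)
    -- NEW «A2»: the compact-type guard; the two-member identities under it, the vanishing companions off it [§12.3 Prop. 12.3.3; §14.4 Props. 14.4.1 (a)(c), 14.4.2 (c); p. 244]
    (cpt : Prop)
    (hR₁ : cpt → ∀ φf (f : TG), (ArchTestKc L ι₀ H T hT φf.1 ∧ (∀ v, IsLocallyConstant (φf.2 v) ∧ HasCompactSupport (φf.2 v)) ∧ {v | φf.2 v ≠ e v}.Finite) →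
      Transfer φf f →
      X.G.packetTrace X.tr P f =
        (-1) ^ (gammaSph _ TG TH L ι₀ H T hT μA Ξ 𝔩 X).N *
          ((archTr₀ L ι₀ H T hT νinf a₀ φf.1 - archTr₀ L ι₀ H T hT νinf a₂ φf.1) *
            ∏ v ∈ T₀ φf with ¬ p v, (letI : MeasurableSpace ((cmDatum L 3 H).Local v) := borel _;
              ((Ξ (X.oneDimOf ξ h₁) v).πn).smoothTrace (μv v) (φf.2 v))) *
          ∏ i ∈ (T₀ φf).subtype p, (letI : MeasurableSpace ((cmDatum L 3 H).Local i) := borel _;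
            (((Ξ (X.oneDimOf ξ h₁) (i : _)).πn).smoothTrace (μv i) (φf.2 i) -
              ((Ξ (X.oneDimOf ξ h₁) (i : _)).πs.getD (Ξ (X.oneDimOf ξ h₁) (i : _)).πn).smoothTrace (μv i) (φf.2 i))))
    (hR₂ : cpt → ∀ φf (fH : TH), (ArchTestKc L ι₀ H T hT φf.1 ∧ (∀ v, IsLocallyConstant (φf.2 v) ∧ HasCompactSupport (φf.2 v)) ∧ {v | φf.2 v ≠ e v}.Finite) →
      TransferH φf fH →
      X.trH ξ fH =
        (-1) ^ (gammaSph _ TG TH L ι₀ H T hT μA Ξ 𝔩 X).N * (gammaSph _ TG TH L ι₀ H T hT μA Ξ 𝔩 X).c *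
          ((archTr₀ L ι₀ H T hT νinf a₀ φf.1 + archTr₀ L ι₀ H T hT νinf a₂ φf.1) *
            ∏ v ∈ T₀ φf with ¬ p v, (letI : MeasurableSpace ((cmDatum L 3 H).Local v) := borel _;
              ((Ξ (X.oneDimOf ξ h₁) v).πn).smoothTrace (μv v) (φf.2 v))) *
          ∏ i ∈ (T₀ φf).subtype p, (letI : MeasurableSpace ((cmDatum L 3 H).Local i) := borel _;
            (((Ξ (X.oneDimOf ξ h₁) (i : _)).πn).smoothTrace (μv i) (φf.2 i) +
              ((Ξ (X.oneDimOf ξ h₁) (i : _)).πs.getD (Ξ (X.oneDimOf ξ h₁) (i : _)).πn).smoothTrace (μv i) (φf.2 i))))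
    (hR₀G : ¬ cpt → ∀ (φf : ((UnitaryGroup.arch (↥(maximalRealSubfield L)) L (IsCMField.complexConj L) 3 H → ℂ) ×
        (∀ v : HeightOneSpectrum (𝓞 ↥(maximalRealSubfield L)), (cmDatum L 3 H).Local v → ℂ))) (f : TG), (ArchTestKc L ι₀ H T hT φf.1 ∧ (∀ v, IsLocallyConstant (φf.2 v) ∧ HasCompactSupport (φf.2 v)) ∧ {v | φf.2 v ≠ e v}.Finite) →
      Transfer φf f → X.G.packetTrace X.tr P f = 0)
    (hR₀H : ¬ cpt → ∀ (φf : ((UnitaryGroup.arch (↥(maximalRealSubfield L)) L (IsCMField.complexConj L) 3 H → ℂ) ×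
        (∀ v : HeightOneSpectrum (𝓞 ↥(maximalRealSubfield L)), (cmDatum L 3 H).Local v → ℂ))) (fH : TH), (ArchTestKc L ι₀ H T hT φf.1 ∧ (∀ v, IsLocallyConstant (φf.2 v) ∧ HasCompactSupport (φf.2 v)) ∧ {v | φf.2 v ≠ e v}.Finite) →
      TransferH φf fH → X.trH ξ fH = 0)
    (h63 : ∀ φf, (ArchTestKc L ι₀ H T hT φf.1 ∧ (∀ v, IsLocallyConstant (φf.2 v) ∧ HasCompactSupport (φf.2 v)) ∧ {v | φf.2 v ≠ e v}.Finite) →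
      ∀ (f : TG) (fH : TH), Transfer φf f → TransferH φf fH →
      HasSum (fun π' => {π' : (gammaSph _ TG TH L ι₀ H T hT μA Ξ 𝔩 X).Rep' | (gammaSph _ TG TH L ι₀ H T hT μA Ξ 𝔩 X).evpRep π' P}.indicator
          (fun π' => ((gammaSph _ TG TH L ι₀ H T hT μA Ξ 𝔩 X).m' π' : ℂ) * (gammaSph _ TG TH L ι₀ H T hT μA Ξ 𝔩 X).tr' π' φf) π')
        (1 / 2 * X.G.packetTrace X.tr P f + 1 / 2 * X.trH ξ fH))
    (hex : ∀ φf, (ArchTestKc L ι₀ H T hT φf.1 ∧ (∀ v, IsLocallyConstant (φf.2 v) ∧ HasCompactSupport (φf.2 v)) ∧ {v | φf.2 v ≠ e v}.Finite) →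
      ∃ (f : TG) (fH : TH), Transfer φf f ∧ TransferH φf fH) :
    ∀ π' : (gammaSph _ TG TH L ι₀ H T hT μA Ξ 𝔩 X).Rep',
      (gammaSph _ TG TH L ι₀ H T hT μA Ξ 𝔩 X).evpRep π' P → (gammaSph _ TG TH L ι₀ H T hT μA Ξ 𝔩 X).m' π' ≠ 0 →
        (gammaSph _ TG TH L ι₀ H T hT μA Ξ 𝔩 X).mem' π' ((gammaSph _ TG TH L ι₀ H T hT μA Ξ 𝔩 X).PiXi' ξ h₁ hS) := by
  have hspec : ∀ π' : RepPrimeSph L ι₀ H T hT μA,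
      ∃ P₀ : DiscreteAutomorphicRep (adelicGroupData (↥(maximalRealSubfield L)) L (IsCMField.complexConj L) 3 H) μA,
        classOf L H μA P₀ = π'.1 ∧ ∀ v, (tupleOf L ι₀ H T hT μA π').2 v = clFinChoice P₀ v :=
    fun π' => ⟨repOf L H μA π'.1, classOf_repOf L H μA π'.1, fun v => rfl⟩
  have hW₀ := tup_mem_supportOfRecord_of_spec L H μA hanis μv e he1 (tupleOf L ι₀ H T hT μA) Set.univ
    (fun π' _ => isCohUnitaryClass_clInfChoiceU_archDegOne L H μA ι₀ T hT (repOf L H μA π'.1))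
    (fun π' _ => ⟨repOf L H μA π'.1, fun v => rfl⟩)
  exact hcoeffMem_gammaSphA2 L ι₀ H T hT νinf μv hdef hν hμ e he μA Ξ 𝔩 hanis X Transfer TransferH (tupleOf L ι₀ H T hT μA) hspec
    (tupleOf_injective_of_letters L ι₀ H T hT μA hdef hanis hF1b hARCH) (fun π' => hW₀ π' (Set.mem_univ _)) htrX h₁ hS p a₀ a₂ ha₀ ha₂ hane
    hun hus hsph hne T₀ hn1 hs0 cpt hR₁ hR₂ hR₀G hR₀H h63 hex

/-! ## §3 `hcoeffMem` «A2» at the packet family of record (= ★ p862535 `hcoeffMem_gammaSph_recordSCD` with the A2 letter group) -/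
include hdef hν hμ he in
/-- **`hcoeffMem` «A2» AT `Ξ := xiPacketFamilyOfRecordSCD`** — `hcoeffMem_gammaSph_tupleOfA2` with the slot letter `hsph` PAID by ★ `finite_setOf_smoothTrace_πn_recordSCD_ne_one`
(record letter `hexc` + unit-test law `he1`), everything else threaded (★ p862535's proof with the A2 group).  CONCLUSION: `∀ π′, Γ.evpRep π′ P → Γ.m′ π′ ≠ 0 → Γ.mem′ π′ (Γ.PiXi′ ξ h₁ hS)`.
[cite: Rogawski1990, §12.2 (2) pp. 173–174; §12.3 Prop. 12.3.3 p. 178; §14.6 Thm. 14.6.4 and its proof pp. 244–245 (chunks p0238 L9 – p0239 L4)] [cite: FlathCorvallis1979, Thm. 3 and Thm. 4] -/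
theorem hcoeffMem_gammaSph_recordSCDA2
    (hanis : ∀ x : Fin 3 → L, Literature.AlgebraicGeometry.ShimuraVarieties.hermForm (cmConjRingHom L) H x x = 0 → x = 0)
    (hF1b : ∀ P₀ Q₀ : DiscreteAutomorphicRep (adelicGroupData (↥(maximalRealSubfield L)) L (IsCMField.complexConj L) 3 H) μA,
      IsKcSpherical L ι₀ H T hT μA P₀ → IsKcSpherical L ι₀ H T hT μA Q₀ →
      P₀.UnitaryEquivOfComponents Q₀ (uFormGroup (Fin 2) (Fin 1)) (cmArchSectionUForm L ι₀ H T hT) (cmCompactFactor L ι₀ H T hT))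
    (hARCH : ArchComponentOfDiscrete L ι₀ H T hT μA)
    (he1 : ∀ᶠ v : HeightOneSpectrum (𝓞 ↥(maximalRealSubfield L)) in Filter.cofinite, ∀ c : IrrClass ((cmDatum L 3 H).Local v),
      c.IsAdmissible → c.IsSpherical (cmLocalIntegralLevel L 3 H v) →
        (letI : MeasurableSpace ((cmDatum L 3 H).Local v) := borel _; c.smoothTrace (μv v) (e v)) = 1)
    (X : DatumInputs ((UnitaryGroup.arch (↥(maximalRealSubfield L)) L (IsCMField.complexConj L) 3 H → ℂ) ×
        (∀ v : HeightOneSpectrum (𝓞 ↥(maximalRealSubfield L)), (cmDatum L 3 H).Local v → ℂ)) TG TH L ι₀ H T hT μA (xiPacketFamilyOfRecordSCD L H hH hHd μω hμu μZ keys hSC) 𝔩)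
    (Transfer : (UnitaryGroup.arch (↥(maximalRealSubfield L)) L (IsCMField.complexConj L) 3 H → ℂ) ×
        (∀ v : HeightOneSpectrum (𝓞 ↥(maximalRealSubfield L)), (cmDatum L 3 H).Local v → ℂ) → TG → Prop)
    (TransferH : (UnitaryGroup.arch (↥(maximalRealSubfield L)) L (IsCMField.complexConj L) 3 H → ℂ) ×
        (∀ v : HeightOneSpectrum (𝓞 ↥(maximalRealSubfield L)), (cmDatum L 3 H).Local v → ℂ) → TH → Prop)
    (htrX : ∀ (π' : RepPrimeSph L ι₀ H T hT μA) (φf : (UnitaryGroup.arch (↥(maximalRealSubfield L)) L (IsCMField.complexConj L) 3 H → ℂ) ×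
        (∀ v : HeightOneSpectrum (𝓞 ↥(maximalRealSubfield L)), (cmDatum L 3 H).Local v → ℂ)),
      X.trPrime π' φf = archTr₀ L ι₀ H T hT νinf (tupleOf L ι₀ H T hT μA π').1 φf.1 *
        ∏ᶠ v, (letI : MeasurableSpace ((cmDatum L 3 H).Local v) := borel _;
          ((tupleOf L ι₀ H T hT μA π').2 v).smoothTrace (μv v) (φf.2 v)))
    {P : X.G.Packet} {ξ : X.G.PacketH} (h₁ : X.IsOneDimH ξ) (hS : ∀ q : InnerFormSec146.Place L, q ∈ S0 L H → X.MnNeZero ξ q)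
    (p : HeightOneSpectrum (𝓞 ↥(maximalRealSubfield L)) → Prop)
    (a₀ a₂ : GKIrrClass (uFormGroup (Fin 2) (Fin 1)))
    (ha₀ : ∃ r : GKIrrep (uFormGroup (Fin 2) (Fin 1)), GKIrrClass.mk r = a₀ ∧ IsAdmissibleGK r.ρK ∧ r.IsInfUnitaryAlongP)
    (ha₂ : ∃ r : GKIrrep (uFormGroup (Fin 2) (Fin 1)), GKIrrClass.mk r = a₂ ∧ IsAdmissibleGK r.ρK ∧ r.IsInfUnitaryAlongP)
    (hane : a₂ ≠ a₀)
    (hun : ∀ v, (((xiPacketFamilyOfRecordSCD L H hH hHd μω hμu μZ keys hSC) (X.oneDimOf ξ h₁) v).πn).IsUnitarizable)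
    (hus : ∀ v, p v → (((xiPacketFamilyOfRecordSCD L H hH hHd μω hμu μZ keys hSC) (X.oneDimOf ξ h₁) v).πs.getD ((xiPacketFamilyOfRecordSCD L H hH hHd μω hμu μZ keys hSC) (X.oneDimOf ξ h₁) v).πn).IsUnitarizable)
    (hne : ∀ i : {v // p v}, ((xiPacketFamilyOfRecordSCD L H hH hHd μω hμu μZ keys hSC) (X.oneDimOf ξ h₁) (i : _)).πs.getD ((xiPacketFamilyOfRecordSCD L H hH hHd μω hμu μZ keys hSC) (X.oneDimOf ξ h₁) (i : _)).πn ≠ ((xiPacketFamilyOfRecordSCD L H hH hHd μω hμu μZ keys hSC) (X.oneDimOf ξ h₁) (i : _)).πn)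
    (T₀ : (UnitaryGroup.arch (↥(maximalRealSubfield L)) L (IsCMField.complexConj L) 3 H → ℂ) ×
        (∀ v : HeightOneSpectrum (𝓞 ↥(maximalRealSubfield L)), (cmDatum L 3 H).Local v → ℂ) →
      Finset (HeightOneSpectrum (𝓞 ↥(maximalRealSubfield L))))
    (hn1 : ∀ φf, (ArchTestKc L ι₀ H T hT φf.1 ∧ (∀ v, IsLocallyConstant (φf.2 v) ∧ HasCompactSupport (φf.2 v)) ∧ {v | φf.2 v ≠ e v}.Finite) →
      ∀ v ∉ T₀ φf, (letI : MeasurableSpace ((cmDatum L 3 H).Local v) := borel _;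
        (((xiPacketFamilyOfRecordSCD L H hH hHd μω hμu μZ keys hSC) (X.oneDimOf ξ h₁) v).πn).smoothTrace (μv v) (φf.2 v)) = 1)
    (hs0 : ∀ φf, (ArchTestKc L ι₀ H T hT φf.1 ∧ (∀ v, IsLocallyConstant (φf.2 v) ∧ HasCompactSupport (φf.2 v)) ∧ {v | φf.2 v ≠ e v}.Finite) →
      ∀ i : {v // p v}, (i : HeightOneSpectrum (𝓞 ↥(maximalRealSubfield L))) ∉ T₀ φf →
        (letI : MeasurableSpace ((cmDatum L 3 H).Local i) := borel _;
          (((xiPacketFamilyOfRecordSCD L H hH hHd μω hμu μZ keys hSC) (X.oneDimOf ξ h₁) (i : _)).πs.getD ((xiPacketFamilyOfRecordSCD L H hH hHd μω hμu μZ keys hSC) (X.oneDimOf ξ h₁) (i : _)).πn).smoothTrace (μv i) (φf.2 i)) = 0)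
    -- NEW «A2»: the compact-type guard; the two-member identities under it, the vanishing companions off it [§12.3 Prop. 12.3.3; §14.4 Props. 14.4.1 (a)(c), 14.4.2 (c); p. 244]
    (cpt : Prop)
    (hR₁ : cpt → ∀ φf (f : TG), (ArchTestKc L ι₀ H T hT φf.1 ∧ (∀ v, IsLocallyConstant (φf.2 v) ∧ HasCompactSupport (φf.2 v)) ∧ {v | φf.2 v ≠ e v}.Finite) →
      Transfer φf f →
      X.G.packetTrace X.tr P f =
        (-1) ^ (gammaSph _ TG TH L ι₀ H T hT μA (xiPacketFamilyOfRecordSCD L H hH hHd μω hμu μZ keys hSC) 𝔩 X).N *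
          ((archTr₀ L ι₀ H T hT νinf a₀ φf.1 - archTr₀ L ι₀ H T hT νinf a₂ φf.1) *
            ∏ v ∈ T₀ φf with ¬ p v, (letI : MeasurableSpace ((cmDatum L 3 H).Local v) := borel _;
              (((xiPacketFamilyOfRecordSCD L H hH hHd μω hμu μZ keys hSC) (X.oneDimOf ξ h₁) v).πn).smoothTrace (μv v) (φf.2 v))) *
          ∏ i ∈ (T₀ φf).subtype p, (letI : MeasurableSpace ((cmDatum L 3 H).Local i) := borel _;
            ((((xiPacketFamilyOfRecordSCD L H hH hHd μω hμu μZ keys hSC) (X.oneDimOf ξ h₁) (i : _)).πn).smoothTrace (μv i) (φf.2 i) -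
              (((xiPacketFamilyOfRecordSCD L H hH hHd μω hμu μZ keys hSC) (X.oneDimOf ξ h₁) (i : _)).πs.getD ((xiPacketFamilyOfRecordSCD L H hH hHd μω hμu μZ keys hSC) (X.oneDimOf ξ h₁) (i : _)).πn).smoothTrace (μv i) (φf.2 i))))
    (hR₂ : cpt → ∀ φf (fH : TH), (ArchTestKc L ι₀ H T hT φf.1 ∧ (∀ v, IsLocallyConstant (φf.2 v) ∧ HasCompactSupport (φf.2 v)) ∧ {v | φf.2 v ≠ e v}.Finite) →
      TransferH φf fH →
      X.trH ξ fH =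
        (-1) ^ (gammaSph _ TG TH L ι₀ H T hT μA (xiPacketFamilyOfRecordSCD L H hH hHd μω hμu μZ keys hSC) 𝔩 X).N * (gammaSph _ TG TH L ι₀ H T hT μA (xiPacketFamilyOfRecordSCD L H hH hHd μω hμu μZ keys hSC) 𝔩 X).c *
          ((archTr₀ L ι₀ H T hT νinf a₀ φf.1 + archTr₀ L ι₀ H T hT νinf a₂ φf.1) *
            ∏ v ∈ T₀ φf with ¬ p v, (letI : MeasurableSpace ((cmDatum L 3 H).Local v) := borel _;
              (((xiPacketFamilyOfRecordSCD L H hH hHd μω hμu μZ keys hSC) (X.oneDimOf ξ h₁) v).πn).smoothTrace (μv v) (φf.2 v))) *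
          ∏ i ∈ (T₀ φf).subtype p, (letI : MeasurableSpace ((cmDatum L 3 H).Local i) := borel _;
            ((((xiPacketFamilyOfRecordSCD L H hH hHd μω hμu μZ keys hSC) (X.oneDimOf ξ h₁) (i : _)).πn).smoothTrace (μv i) (φf.2 i) +
              (((xiPacketFamilyOfRecordSCD L H hH hHd μω hμu μZ keys hSC) (X.oneDimOf ξ h₁) (i : _)).πs.getD ((xiPacketFamilyOfRecordSCD L H hH hHd μω hμu μZ keys hSC) (X.oneDimOf ξ h₁) (i : _)).πn).smoothTrace (μv i) (φf.2 i))))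
    (hR₀G : ¬ cpt → ∀ (φf : ((UnitaryGroup.arch (↥(maximalRealSubfield L)) L (IsCMField.complexConj L) 3 H → ℂ) ×
        (∀ v : HeightOneSpectrum (𝓞 ↥(maximalRealSubfield L)), (cmDatum L 3 H).Local v → ℂ))) (f : TG), (ArchTestKc L ι₀ H T hT φf.1 ∧ (∀ v, IsLocallyConstant (φf.2 v) ∧ HasCompactSupport (φf.2 v)) ∧ {v | φf.2 v ≠ e v}.Finite) →
      Transfer φf f → X.G.packetTrace X.tr P f = 0)
    (hR₀H : ¬ cpt → ∀ (φf : ((UnitaryGroup.arch (↥(maximalRealSubfield L)) L (IsCMField.complexConj L) 3 H → ℂ) ×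
        (∀ v : HeightOneSpectrum (𝓞 ↥(maximalRealSubfield L)), (cmDatum L 3 H).Local v → ℂ))) (fH : TH), (ArchTestKc L ι₀ H T hT φf.1 ∧ (∀ v, IsLocallyConstant (φf.2 v) ∧ HasCompactSupport (φf.2 v)) ∧ {v | φf.2 v ≠ e v}.Finite) →
      TransferH φf fH → X.trH ξ fH = 0)
    (h63 : ∀ φf, (ArchTestKc L ι₀ H T hT φf.1 ∧ (∀ v, IsLocallyConstant (φf.2 v) ∧ HasCompactSupport (φf.2 v)) ∧ {v | φf.2 v ≠ e v}.Finite) →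
      ∀ (f : TG) (fH : TH), Transfer φf f → TransferH φf fH →
      HasSum (fun π' => {π' : (gammaSph _ TG TH L ι₀ H T hT μA (xiPacketFamilyOfRecordSCD L H hH hHd μω hμu μZ keys hSC) 𝔩 X).Rep' | (gammaSph _ TG TH L ι₀ H T hT μA (xiPacketFamilyOfRecordSCD L H hH hHd μω hμu μZ keys hSC) 𝔩 X).evpRep π' P}.indicator
          (fun π' => ((gammaSph _ TG TH L ι₀ H T hT μA (xiPacketFamilyOfRecordSCD L H hH hHd μω hμu μZ keys hSC) 𝔩 X).m' π' : ℂ) * (gammaSph _ TG TH L ι₀ H T hT μA (xiPacketFamilyOfRecordSCD L H hH hHd μω hμu μZ keys hSC) 𝔩 X).tr' π' φf) π')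
        (1 / 2 * X.G.packetTrace X.tr P f + 1 / 2 * X.trH ξ fH))
    (hex : ∀ φf, (ArchTestKc L ι₀ H T hT φf.1 ∧ (∀ v, IsLocallyConstant (φf.2 v) ∧ HasCompactSupport (φf.2 v)) ∧ {v | φf.2 v ≠ e v}.Finite) →
      ∃ (f : TG) (fH : TH), Transfer φf f ∧ TransferH φf fH)
    (hexc : ∀ᶠ v : HeightOneSpectrum (𝓞 ↥(maximalRealSubfield L)) in cofinite,
      ∀ hns : ∀ w : PlacesOver L v, IsCMField.complexConj L • w.1 = w.1,
        ((keys (X.oneDimOf ξ h₁) v hns).1.2).IsSpherical (cmLocalIntegralLevel L 3 (qsForm L) v)) :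
    ∀ π' : (gammaSph _ TG TH L ι₀ H T hT μA (xiPacketFamilyOfRecordSCD L H hH hHd μω hμu μZ keys hSC) 𝔩 X).Rep',
      (gammaSph _ TG TH L ι₀ H T hT μA (xiPacketFamilyOfRecordSCD L H hH hHd μω hμu μZ keys hSC) 𝔩 X).evpRep π' P → (gammaSph _ TG TH L ι₀ H T hT μA (xiPacketFamilyOfRecordSCD L H hH hHd μω hμu μZ keys hSC) 𝔩 X).m' π' ≠ 0 →
        (gammaSph _ TG TH L ι₀ H T hT μA (xiPacketFamilyOfRecordSCD L H hH hHd μω hμu μZ keys hSC) 𝔩 X).mem' π' ((gammaSph _ TG TH L ι₀ H T hT μA (xiPacketFamilyOfRecordSCD L H hH hHd μω hμu μZ keys hSC) 𝔩 X).PiXi' ξ h₁ hS) :=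
  hcoeffMem_gammaSph_tupleOfA2 L ι₀ H T hT νinf μv hdef hν hμ e he μA (xiPacketFamilyOfRecordSCD L H hH hHd μω hμu μZ keys hSC) 𝔩
    hanis hF1b hARCH he1 X Transfer TransferH htrX h₁ hS p a₀ a₂ ha₀ ha₂ hane hun hus
    (finite_setOf_smoothTrace_πn_recordSCD_ne_one L H μv e hH hHd μω hμu μZ keys hSC he1 (X.oneDimOf ξ h₁) hexc)
    hne T₀ hn1 hs0 cpt hR₁ hR₂ hR₀G hR₀H h63 hex

/-! ## §4 THE ROW-34 TOKEN «A2» (= ★ p863643 `…_partnerA'` with the A2 letter group; statement ≡ p07's `A2-STATEMENTS.lean` §B) -/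
include hdef hν hμ in
/-- **THE ROW-34 TOKEN «A2» `hcoeffMem_binder_gammaSph_recordSCD_atUnitsOfRecord_partnerA2'`** — ★ p863643 `…_partnerA'` (the (CMP) binder of FILE B's pay line at the
units of record `e_v := 𝟙_{K_v}`, partner-guarded cover `hcoverP`, level identities at A-packets `hlevTA`) with the ∀-closed letter group `a₀ ha₀ hR₁ hR₂` ↦ `a₀ a₂ ha₀ ha₂ hane
cpt hR₁ hR₂ hR₀G hR₀H` (p07's `A2-STATEMENTS.lean` §B); every other binder and the CONCLUSION token for token.  Proof = ★'s: for a CONTRIBUTING `π′` at `(P, ξ)`,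
`hcoeffMem_gammaSph_recordSCDA2` with the letters discharged (`he`, `he1` under `μ_v(K_v) = 1`, `hun hus hne` ★ slot laws, `T₀ := xiTruncOfRecordSCD`, `hn1 hs0` ★ truncation,
`hexc` ★ letter #79) and `h63 :=` ★ `hasSum_eq1463_at_of_levelA` at the cover of `(φ, P)` supplied by `hcoverP`.
[cite: Rogawski1990, §12.3 Prop. 12.3.3 p. 178; §14.6 p. 242 l. 10–22, Thm. 14.6.4 with its proof pp. 244–245 (chunks p0238 L9 – p0239 L4); §13.3 Thm. 13.3.5 p. 202; Prop. 13.8.1 p. 206] [cite: FlathCorvallis1979, Thm. 3 and Thm. 4] -/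
theorem hcoeffMem_binder_gammaSph_recordSCD_atUnitsOfRecord_partnerA2'
    (hμω : ∀ x : Literature.NumberTheory.GaloisRepresentations.ideleGroup ↥(maximalRealSubfield L),
      μω (AdeleRing.ideleBaseChange (↥(maximalRealSubfield L)) L x) = quadraticHeckeCharCM L x)
    (hquad : ∀ v : HeightOneSpectrum (𝓞 ↥(maximalRealSubfield L)), (∀ w : PlacesOver L v, IsCMField.complexConj L • w.1 = w.1) →
      IsQuadraticCharExtension (conjLocal L (IsCMField.complexConj L) v) (μω.semilocalComponent L v))
    [∀ v : HeightOneSpectrum (𝓞 ↥(maximalRealSubfield L)), BorelSpace (Gqs L v ⧸ Subgroup.center (Gqs L v))]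
    [∀ v : HeightOneSpectrum (𝓞 ↥(maximalRealSubfield L)), (μZ v).IsHaarMeasure]
    (hμK1 : ∀ v : HeightOneSpectrum (𝓞 ↥(maximalRealSubfield L)), μv v (cmLocalIntegralLevel L 3 H v : Set ((cmDatum L 3 H).Local v)) = 1)
    (hanis : ∀ x : Fin 3 → L, Literature.AlgebraicGeometry.ShimuraVarieties.hermForm (cmConjRingHom L) H x x = 0 → x = 0)
    (hF1b : ∀ P₀ Q₀ : DiscreteAutomorphicRep (adelicGroupData (↥(maximalRealSubfield L)) L (IsCMField.complexConj L) 3 H) μA,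
      IsKcSpherical L ι₀ H T hT μA P₀ → IsKcSpherical L ι₀ H T hT μA Q₀ →
      P₀.UnitaryEquivOfComponents Q₀ (uFormGroup (Fin 2) (Fin 1)) (cmArchSectionUForm L ι₀ H T hT) (cmCompactFactor L ι₀ H T hT))
    (hARCH : ArchComponentOfDiscrete L ι₀ H T hT μA)
    (X : DatumInputs ((UnitaryGroup.arch (↥(maximalRealSubfield L)) L (IsCMField.complexConj L) 3 H → ℂ) ×
        (∀ v : HeightOneSpectrum (𝓞 ↥(maximalRealSubfield L)), (cmDatum L 3 H).Local v → ℂ)) TG TH L ι₀ H T hT μA (xiPacketFamilyOfRecordSCD L H hH hHd μω hμu μZ keys hSC) 𝔩)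
    (Transfer : (UnitaryGroup.arch (↥(maximalRealSubfield L)) L (IsCMField.complexConj L) 3 H → ℂ) ×
        (∀ v : HeightOneSpectrum (𝓞 ↥(maximalRealSubfield L)), (cmDatum L 3 H).Local v → ℂ) → TG → Prop)
    (TransferH : (UnitaryGroup.arch (↥(maximalRealSubfield L)) L (IsCMField.complexConj L) 3 H → ℂ) ×
        (∀ v : HeightOneSpectrum (𝓞 ↥(maximalRealSubfield L)), (cmDatum L 3 H).Local v → ℂ) → TH → Prop)
    (htrX : ∀ (π' : RepPrimeSph L ι₀ H T hT μA) (φf : (UnitaryGroup.arch (↥(maximalRealSubfield L)) L (IsCMField.complexConj L) 3 H → ℂ) ×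
        (∀ v : HeightOneSpectrum (𝓞 ↥(maximalRealSubfield L)), (cmDatum L 3 H).Local v → ℂ)),
      X.trPrime π' φf = archTr₀ L ι₀ H T hT νinf (tupleOf L ι₀ H T hT μA π').1 φf.1 *
        ∏ᶠ v, (letI : MeasurableSpace ((cmDatum L 3 H).Local v) := borel _;
          ((tupleOf L ι₀ H T hT μA π').2 v).smoothTrace (μv v) (φf.2 v)))
    (p : ∀ ξ : X.G.PacketH, X.IsOneDimH ξ → HeightOneSpectrum (𝓞 ↥(maximalRealSubfield L)) → Prop)
    (hp : ∀ (ξ : X.G.PacketH) (h₁ : X.IsOneDimH ξ) (v : HeightOneSpectrum (𝓞 ↥(maximalRealSubfield L))), p ξ h₁ v →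
      ∀ w : PlacesOver L v, IsCMField.complexConj L • w.1 = w.1)
    -- «A2»: the two archimedean members `πⁿ(ξ_ι) = a₀`, `πˢ(ξ_ι) = a₂` [§12.3 Prop. 12.3.3], the compact-type guard, the identities under it, the vanishing companions off it
    (a₀ a₂ : ∀ ξ : X.G.PacketH, X.IsOneDimH ξ → GKIrrClass (uFormGroup (Fin 2) (Fin 1)))
    (ha₀ : ∀ (ξ : X.G.PacketH) (h₁ : X.IsOneDimH ξ), ∃ r : GKIrrep (uFormGroup (Fin 2) (Fin 1)), GKIrrClass.mk r = a₀ ξ h₁ ∧ IsAdmissibleGK r.ρK ∧ r.IsInfUnitaryAlongP)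
    (ha₂ : ∀ (ξ : X.G.PacketH) (h₁ : X.IsOneDimH ξ), ∃ r : GKIrrep (uFormGroup (Fin 2) (Fin 1)), GKIrrClass.mk r = a₂ ξ h₁ ∧ IsAdmissibleGK r.ρK ∧ r.IsInfUnitaryAlongP)
    (hane : ∀ (ξ : X.G.PacketH) (h₁ : X.IsOneDimH ξ), a₂ ξ h₁ ≠ a₀ ξ h₁)
    (cpt : ∀ ξ : X.G.PacketH, X.IsOneDimH ξ → Prop)
    (hR₁ : ∀ (P : X.G.Packet) (ξ : X.G.PacketH) (h₁ : X.IsOneDimH ξ), X.G.IsAPacket P → X.G.liftsTo ξ P → cpt ξ h₁ →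
      ∀ φf (f : TG), (ArchTestKc L ι₀ H T hT φf.1 ∧ (∀ v, IsLocallyConstant (φf.2 v) ∧ HasCompactSupport (φf.2 v)) ∧ {v | φf.2 v ≠ (cmLocalIntegralLevel L 3 H v : Set ((cmDatum L 3 H).Local v)).indicator fun _ => (1 : ℂ)}.Finite) →
      Transfer φf f →
      X.G.packetTrace X.tr P f =
        (-1) ^ (gammaSph _ TG TH L ι₀ H T hT μA (xiPacketFamilyOfRecordSCD L H hH hHd μω hμu μZ keys hSC) 𝔩 X).N *
          ((archTr₀ L ι₀ H T hT νinf (a₀ ξ h₁) φf.1 - archTr₀ L ι₀ H T hT νinf (a₂ ξ h₁) φf.1) *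
            ∏ v ∈ (xiTruncOfRecordSCD L H hH hHd μω hμu μZ keys hSC μv (X.oneDimOf ξ h₁) φf.2) with ¬ p ξ h₁ v, (letI : MeasurableSpace ((cmDatum L 3 H).Local v) := borel _;
              (((xiPacketFamilyOfRecordSCD L H hH hHd μω hμu μZ keys hSC) (X.oneDimOf ξ h₁) v).πn).smoothTrace (μv v) (φf.2 v))) *
          ∏ i ∈ (xiTruncOfRecordSCD L H hH hHd μω hμu μZ keys hSC μv (X.oneDimOf ξ h₁) φf.2).subtype (p ξ h₁), (letI : MeasurableSpace ((cmDatum L 3 H).Local i) := borel _;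
            ((((xiPacketFamilyOfRecordSCD L H hH hHd μω hμu μZ keys hSC) (X.oneDimOf ξ h₁) (i : _)).πn).smoothTrace (μv i) (φf.2 i) -
              (((xiPacketFamilyOfRecordSCD L H hH hHd μω hμu μZ keys hSC) (X.oneDimOf ξ h₁) (i : _)).πs.getD ((xiPacketFamilyOfRecordSCD L H hH hHd μω hμu μZ keys hSC) (X.oneDimOf ξ h₁) (i : _)).πn).smoothTrace (μv i) (φf.2 i))))
    (hR₂ : ∀ (ξ : X.G.PacketH) (h₁ : X.IsOneDimH ξ), cpt ξ h₁ → ∀ φf (fH : TH), (ArchTestKc L ι₀ H T hT φf.1 ∧ (∀ v, IsLocallyConstant (φf.2 v) ∧ HasCompactSupport (φf.2 v)) ∧ {v | φf.2 v ≠ (cmLocalIntegralLevel L 3 H v : Set ((cmDatum L 3 H).Local v)).indicator fun _ => (1 : ℂ)}.Finite) →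
      TransferH φf fH →
      X.trH ξ fH =
        (-1) ^ (gammaSph _ TG TH L ι₀ H T hT μA (xiPacketFamilyOfRecordSCD L H hH hHd μω hμu μZ keys hSC) 𝔩 X).N * (gammaSph _ TG TH L ι₀ H T hT μA (xiPacketFamilyOfRecordSCD L H hH hHd μω hμu μZ keys hSC) 𝔩 X).c *
          ((archTr₀ L ι₀ H T hT νinf (a₀ ξ h₁) φf.1 + archTr₀ L ι₀ H T hT νinf (a₂ ξ h₁) φf.1) *
            ∏ v ∈ (xiTruncOfRecordSCD L H hH hHd μω hμu μZ keys hSC μv (X.oneDimOf ξ h₁) φf.2) with ¬ p ξ h₁ v, (letI : MeasurableSpace ((cmDatum L 3 H).Local v) := borel _;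
              (((xiPacketFamilyOfRecordSCD L H hH hHd μω hμu μZ keys hSC) (X.oneDimOf ξ h₁) v).πn).smoothTrace (μv v) (φf.2 v))) *
          ∏ i ∈ (xiTruncOfRecordSCD L H hH hHd μω hμu μZ keys hSC μv (X.oneDimOf ξ h₁) φf.2).subtype (p ξ h₁), (letI : MeasurableSpace ((cmDatum L 3 H).Local i) := borel _;
            ((((xiPacketFamilyOfRecordSCD L H hH hHd μω hμu μZ keys hSC) (X.oneDimOf ξ h₁) (i : _)).πn).smoothTrace (μv i) (φf.2 i) +
              (((xiPacketFamilyOfRecordSCD L H hH hHd μω hμu μZ keys hSC) (X.oneDimOf ξ h₁) (i : _)).πs.getD ((xiPacketFamilyOfRecordSCD L H hH hHd μω hμu μZ keys hSC) (X.oneDimOf ξ h₁) (i : _)).πn).smoothTrace (μv i) (φf.2 i))))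
    (hR₀G : ∀ (P : X.G.Packet) (ξ : X.G.PacketH) (h₁ : X.IsOneDimH ξ), X.G.IsAPacket P → X.G.liftsTo ξ P → ¬ cpt ξ h₁ →
      ∀ (φf : ((UnitaryGroup.arch (↥(maximalRealSubfield L)) L (IsCMField.complexConj L) 3 H → ℂ) ×
        (∀ v : HeightOneSpectrum (𝓞 ↥(maximalRealSubfield L)), (cmDatum L 3 H).Local v → ℂ))) (f : TG), (ArchTestKc L ι₀ H T hT φf.1 ∧ (∀ v, IsLocallyConstant (φf.2 v) ∧ HasCompactSupport (φf.2 v)) ∧ {v | φf.2 v ≠ (cmLocalIntegralLevel L 3 H v : Set ((cmDatum L 3 H).Local v)).indicator fun _ => (1 : ℂ)}.Finite) →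
      Transfer φf f → X.G.packetTrace X.tr P f = 0)
    (hR₀H : ∀ (ξ : X.G.PacketH) (h₁ : X.IsOneDimH ξ), ¬ cpt ξ h₁ →
      ∀ (φf : ((UnitaryGroup.arch (↥(maximalRealSubfield L)) L (IsCMField.complexConj L) 3 H → ℂ) ×
        (∀ v : HeightOneSpectrum (𝓞 ↥(maximalRealSubfield L)), (cmDatum L 3 H).Local v → ℂ))) (fH : TH), (ArchTestKc L ι₀ H T hT φf.1 ∧ (∀ v, IsLocallyConstant (φf.2 v) ∧ HasCompactSupport (φf.2 v)) ∧ {v | φf.2 v ≠ (cmLocalIntegralLevel L 3 H v : Set ((cmDatum L 3 H).Local v)).indicator fun _ => (1 : ℂ)}.Finite) →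
      TransferH φf fH → X.trH ξ fH = 0)
    {Λ : Type} (𝓕 : Λ → ((UnitaryGroup.arch (↥(maximalRealSubfield L)) L (IsCMField.complexConj L) 3 H → ℂ) ×
        (∀ v : HeightOneSpectrum (𝓞 ↥(maximalRealSubfield L)), (cmDatum L 3 H).Local v → ℂ)) → Prop)
    (hsum𝓕 : ∀ (l : Λ) (f' : (UnitaryGroup.arch (↥(maximalRealSubfield L)) L (IsCMField.complexConj L) 3 H → ℂ) ×
        (∀ v : HeightOneSpectrum (𝓞 ↥(maximalRealSubfield L)), (cmDatum L 3 H).Local v → ℂ)),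
      𝓕 l f' → Summable (fun π' : (InnerFormSec146.RepPrimeSph L ι₀ H T hT μA) => (InnerFormSec146.mPrimeSph L ι₀ H T hT μA π' : ℂ) * X.trPrime π' f'))
    {E : Λ → Type}
    (tR : ∀ l, (InnerFormSec146.RepPrimeSph L ι₀ H T hT μA) → Option (E l)) (tP : ∀ l, X.G.Packet → Option (E l))
    (hcoverP : ∀ (f' : (UnitaryGroup.arch (↥(maximalRealSubfield L)) L (IsCMField.complexConj L) 3 H → ℂ) ×
        (∀ v : HeightOneSpectrum (𝓞 ↥(maximalRealSubfield L)), (cmDatum L 3 H).Local v → ℂ)) (f : TG) (P : X.G.Packet),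
      (ArchTestKc L ι₀ H T hT f'.1 ∧ (∀ v, IsLocallyConstant (f'.2 v) ∧ HasCompactSupport (f'.2 v)) ∧
        {v | f'.2 v ≠ (cmLocalIntegralLevel L 3 H v : Set ((cmDatum L 3 H).Local v)).indicator fun _ => (1 : ℂ)}.Finite) →
      (∃ π' : (InnerFormSec146.RepPrimeSph L ι₀ H T hT μA), InnerFormSec146.mPrimeSph L ι₀ H T hT μA π' ≠ 0 ∧ InnerFormSec146.evpRep L H μA 𝔩 π'.1 (X.finOfG P)) →
      Transfer f' f → ∃ (l : Λ) (e : E l), 𝓕 l f' ∧ tP l P = some e)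
    (hlevTA : ∀ (l : Λ) (f' : (UnitaryGroup.arch (↥(maximalRealSubfield L)) L (IsCMField.complexConj L) 3 H → ℂ) ×
        (∀ v : HeightOneSpectrum (𝓞 ↥(maximalRealSubfield L)), (cmDatum L 3 H).Local v → ℂ)) (f : TG) (fH : TH),
      𝓕 l f' → Transfer f' f → TransferH f' fH →
      ∀ (P : X.G.Packet) (ξ : X.G.PacketH), X.G.IsAPacket P → X.IsOneDimH ξ → X.G.liftsTo ξ P → ∀ (e : E l), tP l P = some e →
        (∑' π' : tR l ⁻¹' {some e}, (InnerFormSec146.mPrimeSph L ι₀ H T hT μA (π' : InnerFormSec146.RepPrimeSph L ι₀ H T hT μA) : ℂ) * X.trPrime π' f') =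
          X.G.n P * X.G.packetTrace X.tr P f + 1 / 2 * X.G.endoSum X.trH P fH)
    (hgerm : ∀ l (π' : (InnerFormSec146.RepPrimeSph L ι₀ H T hT μA)) (P : X.G.Packet) (e : E l), tP l P = some e → tR l π' = some e →
      InnerFormSec146.evpRep L H μA 𝔩 π'.1 (X.finOfG P))
    (hrig : ∀ (l : Λ) (f' : (UnitaryGroup.arch (↥(maximalRealSubfield L)) L (IsCMField.complexConj L) 3 H → ℂ) ×
        (∀ v : HeightOneSpectrum (𝓞 ↥(maximalRealSubfield L)), (cmDatum L 3 H).Local v → ℂ)),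
      𝓕 l f' → ∀ (π' : (InnerFormSec146.RepPrimeSph L ι₀ H T hT μA)) (P : X.G.Packet) (e : E l), tP l P = some e →
        InnerFormSec146.evpRep L H μA 𝔩 π'.1 (X.finOfG P) → (InnerFormSec146.mPrimeSph L ι₀ H T hT μA π' : ℂ) * X.trPrime π' f' ≠ 0 → tR l π' = some e)
    (hlifts : ∀ (P : X.G.Packet) (ξ : X.G.PacketH), X.G.IsAPacket P → X.IsOneDimH ξ → X.G.liftsTo ξ P → X.G.lifts P = {ξ})
    (hn : ∀ (P : X.G.Packet) (ξ : X.G.PacketH), X.G.IsAPacket P → X.IsOneDimH ξ → X.G.liftsTo ξ P → X.G.n P = 1 / 2)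
    (hnH : ∀ ξ : X.G.PacketH, X.IsOneDimH ξ → X.G.nH ξ = 1)
    (hex : ∀ φf, (ArchTestKc L ι₀ H T hT φf.1 ∧ (∀ v, IsLocallyConstant (φf.2 v) ∧ HasCompactSupport (φf.2 v)) ∧ {v | φf.2 v ≠ (cmLocalIntegralLevel L 3 H v : Set ((cmDatum L 3 H).Local v)).indicator fun _ => (1 : ℂ)}.Finite) →
      ∃ (f : TG) (fH : TH), Transfer φf f ∧ TransferH φf fH) :
    InnerFormSec146.DSplit L H → ∀ (P : X.G.Packet) (ξ : X.G.PacketH) (h₁ : X.IsOneDimH ξ)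
      (hS : ∀ v : InnerFormSec146.Place L, v ∈ InnerFormSec146.S0 L H → X.MnNeZero ξ v),
      X.G.IsAPacket P → X.G.liftsTo ξ P → ∀ π' : (InnerFormSec146.RepPrimeSph L ι₀ H T hT μA), InnerFormSec146.evpRep L H μA 𝔩 π'.1 (X.finOfG P) →
        InnerFormSec146.mPrimeSph L ι₀ H T hT μA π' ≠ 0 →
          InnerFormSec146.memPrime L H μA (xiPacketFamilyOfRecordSCD L H hH hHd μω hμu μZ keys hSC) π'.1
            (InnerFormSec146.piXiPrime L H μA (xiPacketFamilyOfRecordSCD L H hH hHd μω hμu μZ keys hSC) (X.oneDimOf ξ h₁)) := by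
  intro _ P ξ h₁ hS hA hl π' hevp hm
  exact hcoeffMem_gammaSph_recordSCDA2 L ι₀ H T hT νinf μv hdef hν hμ
    (fun v => (cmLocalIntegralLevel L 3 H v : Set ((cmDatum L 3 H).Local v)).indicator fun _ => (1 : ℂ))
    (fun v => ⟨(IsLevel.indicator (isCompact_isOpen_cmLocalIntegralLevel L 3 H v).2 (isCompact_isOpen_cmLocalIntegralLevel L 3 H v).1).isLocallyConstant,
      Literature.Topology.hasCompactSupport_indicator_of_isCompact (isCompact_isOpen_cmLocalIntegralLevel L 3 H v).1 _⟩)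
    hH hHd μω hμu μZ keys hSC μA 𝔩 hanis hF1b hARCH (eventually_smoothTrace_indicator_eq_one_of_isSpherical L H μv hμ hμK1) X Transfer TransferH htrX h₁ hS
    (p ξ h₁) (a₀ ξ h₁) (a₂ ξ h₁) (ha₀ ξ h₁) (ha₂ ξ h₁) (hane ξ h₁)
    (fun v => isUnitarizable_πn_recordSCD L H hH hHd μω hμu μZ keys hSC hμω (X.oneDimOf ξ h₁) v)
    (fun v hv => isUnitarizable_πs_getD_recordSCD_of_nonsplit L H hH hHd μω hμu μZ keys hSC (X.oneDimOf ξ h₁) v (hp ξ h₁ v hv))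
    (fun i => πs_getD_ne_πn_recordSCD_of_nonsplit L H hH hHd μω hμu μZ keys hSC (X.oneDimOf ξ h₁) i (hp ξ h₁ i i.2))
    (fun φf => xiTruncOfRecordSCD L H hH hHd μω hμu μZ keys hSC μv (X.oneDimOf ξ h₁) φf.2)
    (fun φf hφ v hv => smoothTrace_πn_eq_one_of_not_mem_xiTruncOfRecordSCD L H hH hHd μω hμu μZ keys hSC μv hμ hμK1 hquad (X.oneDimOf ξ h₁) φf.2 hφ.2.2 v hv)
    (fun φf hφ i hi => smoothTrace_πs_eq_zero_of_not_mem_xiTruncOfRecordSCD L H hH hHd μω hμu μZ keys hSC μv hμ hμK1 hquad (X.oneDimOf ξ h₁) φf.2 hφ.2.2 i (hp ξ h₁ i i.2) hi)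
    (cpt ξ h₁) (hR₁ P ξ h₁ hA hl) (hR₂ ξ h₁) (hR₀G P ξ h₁ hA hl) (hR₀H ξ h₁)
    (fun φf hφ f fH hf hfH => by
      obtain ⟨l, e, hF, hP⟩ := hcoverP φf f P hφ ⟨π', hm, hevp⟩ hf
      exact hasSum_eq1463_at_of_levelA (gammaSph _ TG TH L ι₀ H T hT μA (xiPacketFamilyOfRecordSCD L H hH hHd μω hμu μZ keys hSC) 𝔩 X)
        𝓕 hsum𝓕 tR tP hgerm hrig P ξ φf f fH hF hP (hlevTA l φf f fH hF hf hfH P ξ hA h₁ hl e hP)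
        (hn P ξ hA h₁ hl) (hlifts P ξ hA h₁ hl) (hnH ξ h₁))
    hex
    (F0P3XiPacketFamilyOfRecord.hexc_of_xiPinSphericalCofinite L μω hμu μZ keys hquad
      (F0P3XiPinSphericalCofiniteHolds.xiPinSphericalCofinite_holds L) (X.oneDimOf ξ h₁))
    π' hevp hm

end ChainA2

end Summit.HodgeConjecture.HodgeConjecture.R90.S9

end
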